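import Literature.Analysis.FluidPDE.SereginZajaczkowski2007L42VorticityProofs
import HarnessLib

/-!
# Wei 2016, (1.1)₂ / (1.3): the transport–diffusion equation of `u_θ/r = Γ/r²` off the axis

Analysis/FluidPDE proof file (theorems only) on the way to
`Literature.Analysis.FluidPDE.Wei2016_logModulus_regularity`
(`LeiZhang2017AxisymmetricCriteria.lean`), after

* D. Wei, *Regularity criterion to the axially symmetric Navier–Stokes equations*, J. Math. Anal.
  Appl. 435 (2016) 402–413 = arXiv:1508.03318, §1: the swirl equation (1.3)
  `∂ₜΓ + u·∇Γ − ΔΓ + (2/r)∂ᵣΓ = 0` (`Γ = r u_θ`) and the `u_θ`-equation of (1.1),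
  `∂ₜu_θ + u·∇u_θ − Δu_θ + u_θ/r² + u_r u_θ/r = 0`.

For the energy estimates of `J = −∂_z(u_θ/r)` one needs the equation of the quotient
`q = u_θ/r = Γ/r²`: dividing (1.3) by `r²`,

  `∂ₜq + u·∇q + 2(u_r/r) q = ν(Δ + (2/r)∂ᵣ) q`     (off the axis)

(the operator `Δ + (2/r)∂ᵣ` of (1.5); `ν = 1` in the paper). This file proves it for classical
Navier–Stokes solutions on `ℝ³ × S` with axisymmetric velocity (and force), from the tree's
PROVED swirl equation `swirl_transport_holds` (KNSS 2009, (1.8)) and the pointwise Leibniz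
rules for multiplication by `r⁻²`:

* calculus of `r⁻²` off the axis: `hasFDerivAt_inv_cylRadius_sq` (`∇r⁻² = −2r⁻³ e_r`),
  `laplacian_inv_cylRadius_sq` (`Δr⁻² = 4r⁻⁴`);
* `fderiv_swirl_div_sq_apply`, `convect_swirl_div_sq`, `laplacian_swirl_div_sq`,
  `laplacian_add_drift_swirl_div_sq` (`(Δ + (2/r)∂ᵣ)(Γ/r²) = r⁻²(ΔΓ − (2/r)∂ᵣΓ)`);
* `Wei2016.swirlQuot_transport` — **the equation of `q = Γ/r²`** at every `t ∈ S` and every `x`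
  off the axis, for `IsClassicalNSSolutionOn S ν f u p` with `UniqueDiffOn ℝ S`, axisymmetric `u t`
  and `f t` (the pressure is then axisymmetric, `isAxisymmetricScalar_pressure`):
  `∂ₜq + Dq[u] + 2(u_r/r) q = ν(Δq + (2/r) Dq[e_r]) + (swirl f)/r²`.

Off the axis `q = Γ/r²` agrees with the `C²` extension `Wei2016.swirlQuot u` of `u_θ/r`
(`Wei2016SwirlQuotient.lean`, `swirlQuot_eq_swirl_div_sq`).

## References

* D. Wei, arXiv:1508.03318, §1, (1.1) and (1.3). [Wei2016]
* G. Koch, N. Nadirashvili, G. Seregin, V. Šverák, Acta Math. 203 (2009), (1.8) (the swirl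
  equation; tree: `swirl_transport_holds`). [KochNadirashviliSereginSverak2009]
-/

noncomputable section

open MeasureTheory Set Function Filter Topology TopologicalSpace Metric WithLp
open scoped NNReal ENNReal ContDiff InnerProductSpace RealInnerProductSpace Laplacian

namespace Literature.Analysis.FluidPDE

namespace Wei2016

open SereginZajaczkowski2007

variable {u : EuclideanSpace ℝ (Fin 3) → EuclideanSpace ℝ (Fin 3)} {x : EuclideanSpace ℝ (Fin 3)}

/-! ### Calculus of `r⁻²` off the axis -/

/-- **`∇(r⁻²) = −2 r⁻³ e_r`** off the axis. [folklore] -/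
theorem hasFDerivAt_inv_cylRadius_sq (hx : cylRadius x ≠ 0) :
    HasFDerivAt (fun y : EuclideanSpace ℝ (Fin 3) => (cylRadius y ^ 2)⁻¹)
      ((-2 * (cylRadius x ^ 3)⁻¹) • (innerSL ℝ (eR x))) x := by
  have h := (hasFDerivAt_inv (pow_ne_zero 2 hx)).comp x ((hasFDerivAt_cylRadius hx).pow 2)
  refine h.congr_fderiv ?_
  ext v
  simp only [ContinuousLinearMap.comp_apply, ContinuousLinearMap.toSpanSingleton_apply,
    _root_.smul_apply, smul_eq_mul, innerSL_apply_apply, nsmul_eq_mul, Nat.cast_ofNat]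
  field_simp
  ring

/-- Directional derivatives of `r⁻²` off the axis: `D(r⁻²)(x)[v] = −2 r⁻³ ⟪e_r, v⟫`. [folklore] -/
theorem fderiv_inv_cylRadius_sq_apply (hx : cylRadius x ≠ 0) (v : EuclideanSpace ℝ (Fin 3)) :
    fderiv ℝ (fun y : EuclideanSpace ℝ (Fin 3) => (cylRadius y ^ 2)⁻¹) x v =
      -2 * (cylRadius x ^ 3)⁻¹ * ⟪eR x, v⟫ := by
  rw [(hasFDerivAt_inv_cylRadius_sq hx).fderiv, _root_.smul_apply, innerSL_apply_apply, smul_eq_mul]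

/-- A global `C²` representative of `r⁻¹` near a point off the axis (the tree's localisation
device, `ContDiffOn.exists_contDiff_eqOn_nhds_of_isCompact`). [folklore] -/
theorem exists_contDiff_rep_inv_cylRadius (hx : cylRadius x ≠ 0) :
    ∃ r' : EuclideanSpace ℝ (Fin 3) → ℝ, ContDiff ℝ 2 r' ∧
      r' =ᶠ[𝓝 x] fun y => (cylRadius y)⁻¹ := by
  have hA : IsOpen {y : EuclideanSpace ℝ (Fin 3) | cylRadius y ≠ 0} :=
    isOpen_ne_fun continuous_cylRadius continuous_const
  have hr : ContDiffOn ℝ 2 (fun y : EuclideanSpace ℝ (Fin 3) => (cylRadius y)⁻¹)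
      {y | cylRadius y ≠ 0} :=
    fun y hy => ((contDiffAt_cylRadius hy).inv hy).contDiffWithinAt
  obtain ⟨r', hr', N', hN', hxN', -, hrN'⟩ := ContDiffOn.exists_contDiff_eqOn_nhds_of_isCompact
    hr hA isCompact_singleton (singleton_subset_iff.2 hx)
  rw [singleton_subset_iff] at hxN'
  exact ⟨r', hr', by
    filter_upwards [hN'.mem_nhds hxN'] with y hy
    exact hrN' hy⟩

/-- **`Δ(r⁻²) = 4 r⁻⁴`** off the axis (`r⁻² = (r⁻¹)²`, Leibniz: `2 r⁻¹ Δr⁻¹ + 2|∇r⁻¹|² =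
2r⁻⁴ + 2r⁻⁴`). [folklore] -/
theorem laplacian_inv_cylRadius_sq (hx : cylRadius x ≠ 0) :
    (Δ fun y : EuclideanSpace ℝ (Fin 3) => (cylRadius y ^ 2)⁻¹) x = 4 * (cylRadius x ^ 4)⁻¹ := by
  obtain ⟨r', hr', e4⟩ := exists_contDiff_rep_inv_cylRadius hx
  have e : (fun y : EuclideanSpace ℝ (Fin 3) => (cylRadius y ^ 2)⁻¹) =ᶠ[𝓝 x] fun y => r' y * r' y := by
    filter_upwards [e4] with y hy
    rw [hy, ← mul_inv, pow_two]
  set b := EuclideanSpace.basisFun (Fin 3) ℝ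
  rw [(InnerProductSpace.laplacian_congr_nhds e).eq_of_nhds, laplacian_mul_eq b hr' hr' x]
  have p1 : r' x = (cylRadius x)⁻¹ := e4.eq_of_nhds
  have p2 : (Δ r') x = (cylRadius x ^ 3)⁻¹ := by
    rw [(InnerProductSpace.laplacian_congr_nhds e4).eq_of_nhds, laplacian_inv_cylRadius hx]
  have p3 : ∀ a, fderiv ℝ r' x a = -(cylRadius x ^ 2)⁻¹ * ⟪eR x, a⟫ := fun a => by
    rw [e4.fderiv_eq, (hasFDerivAt_inv_cylRadius hx).fderiv, _root_.smul_apply,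
      innerSL_apply_apply, smul_eq_mul]
  have p4 : ∑ i, fderiv ℝ r' x (b i) * fderiv ℝ r' x (b i) = (cylRadius x ^ 4)⁻¹ := by
    simp_rw [p3]
    have h : ∑ i, -(cylRadius x ^ 2)⁻¹ * ⟪eR x, b i⟫ * (-(cylRadius x ^ 2)⁻¹ * ⟪eR x, b i⟫) =
        (cylRadius x ^ 2)⁻¹ * (cylRadius x ^ 2)⁻¹ * ∑ i, ⟪eR x, b i⟫ * ⟪b i, eR x⟫ := by
      rw [Finset.mul_sum]
      refine Finset.sum_congr rfl fun i _ => ?_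
      rw [real_inner_comm (b i)]
      ring
    rw [h, b.sum_inner_mul_inner, inner_eR_self hx]
    ring
  rw [p1, p2, p4]
  field_simp
  ring

/-! ### Leibniz rules for `q = Γ · r⁻²` -/

/-- **The derivative of `q = Γ/r²` off the axis**: `Dq[v] = r⁻² DΓ[v] − 2 r⁻³ Γ ⟪e_r, v⟫`.
[folklore] -/
theorem fderiv_swirl_div_sq_apply (hx : cylRadius x ≠ 0) (hd : DifferentiableAt ℝ u x)
    (v : EuclideanSpace ℝ (Fin 3)) :
    fderiv ℝ (fun y => swirl u y * (cylRadius y ^ 2)⁻¹) x v =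
      (cylRadius x ^ 2)⁻¹ * fderiv ℝ (swirl u) x v -
        2 * (cylRadius x ^ 3)⁻¹ * swirl u x * ⟪eR x, v⟫ := by
  rw [((differentiableAt_swirl hd).hasFDerivAt.fun_mul (hasFDerivAt_inv_cylRadius_sq hx)).fderiv]
  simp only [_root_.add_apply, _root_.smul_apply, innerSL_apply_apply, smul_eq_mul]
  ring

/-- **The convective derivative of `q`**: `Dq[u] = r⁻² DΓ[u] − 2 (u_r/r) q`
(`⟪e_r, u⟫ = u_r`). [folklore] -/
theorem convect_swirl_div_sq (hx : cylRadius x ≠ 0) (hd : DifferentiableAt ℝ u x) :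
    convect u (fun y => swirl u y * (cylRadius y ^ 2)⁻¹) x =
      (cylRadius x ^ 2)⁻¹ * convect u (swirl u) x -
        2 * (radialVelocity u x / cylRadius x) * (swirl u x * (cylRadius x ^ 2)⁻¹) := by
  rw [convect_apply, convect_apply, fderiv_swirl_div_sq_apply hx hd, radialVelocity, real_inner_comm]
  field_simp

/-- **The Laplacian of `q = Γ/r²` off the axis**: `Δq = r⁻² ΔΓ − 4 r⁻³ ∂ᵣΓ + 4 r⁻⁴ Γ`
(`∂ᵣ = D(·)[e_r]`), for `u ∈ C³`. [folklore] -/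
theorem laplacian_swirl_div_sq (hx : cylRadius x ≠ 0) (hu : ContDiff ℝ 3 u) :
    (Δ fun y => swirl u y * (cylRadius y ^ 2)⁻¹) x =
      (cylRadius x ^ 2)⁻¹ * (Δ (swirl u)) x -
        4 * (cylRadius x ^ 3)⁻¹ * fderiv ℝ (swirl u) x (eR x) +
        4 * (cylRadius x ^ 4)⁻¹ * swirl u x := by
  -- a global `C²` representative `w'` of `r⁻²` near `x`
  obtain ⟨r', hr', e4⟩ := exists_contDiff_rep_inv_cylRadius hx
  set w' : EuclideanSpace ℝ (Fin 3) → ℝ := fun y => r' y * r' y with hw'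
  have hw'c : ContDiff ℝ 2 w' := hr'.mul hr'
  have ew : w' =ᶠ[𝓝 x] fun y => (cylRadius y ^ 2)⁻¹ := by
    filter_upwards [e4] with y hy
    simp only [hw', hy, ← mul_inv, pow_two]
  have hΓ : ContDiff ℝ 2 (swirl u) := contDiff_swirl (hu.of_le (by norm_num))
  have e : (fun y => swirl u y * (cylRadius y ^ 2)⁻¹) =ᶠ[𝓝 x] fun y => swirl u y * w' y := by
    filter_upwards [ew] with y hy
    rw [hy]
  set b := EuclideanSpace.basisFun (Fin 3) ℝ
  rw [(InnerProductSpace.laplacian_congr_nhds e).eq_of_nhds, laplacian_mul_eq b hΓ hw'c x]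
  have p1 : w' x = (cylRadius x ^ 2)⁻¹ := ew.eq_of_nhds
  have p2 : (Δ w') x = 4 * (cylRadius x ^ 4)⁻¹ := by
    rw [(InnerProductSpace.laplacian_congr_nhds ew).eq_of_nhds, laplacian_inv_cylRadius_sq hx]
  have p3 : ∀ a, fderiv ℝ w' x a = -2 * (cylRadius x ^ 3)⁻¹ * ⟪eR x, a⟫ := fun a => by
    rw [ew.fderiv_eq, fderiv_inv_cylRadius_sq_apply hx a]
  have p4 : ∑ i, fderiv ℝ (swirl u) x (b i) * fderiv ℝ w' x (b i) =
      -2 * (cylRadius x ^ 3)⁻¹ * fderiv ℝ (swirl u) x (eR x) := by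
    simp_rw [p3]
    have h : ∑ i, fderiv ℝ (swirl u) x (b i) * (-2 * (cylRadius x ^ 3)⁻¹ * ⟪eR x, b i⟫) =
        -2 * (cylRadius x ^ 3)⁻¹ * fderiv ℝ (swirl u) x (∑ i, ⟪b i, eR x⟫ • b i) := by
      rw [map_sum, Finset.mul_sum]
      refine Finset.sum_congr rfl fun i _ => ?_
      rw [map_smul, smul_eq_mul, real_inner_comm]
      ring
    rw [h, b.sum_repr']
  rw [p1, p2, p4]
  ring

/-- **`(Δ + (2/r)∂ᵣ) q = r⁻² (ΔΓ − (2/r)∂ᵣΓ)`** for `q = Γ/r²` off the axis: the drift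
`(2/r)∂ᵣ` of Wei's operator applied to the quotient reproduces the `−(2/r)∂ᵣΓ` of the swirl
equation (1.3). [cite: Wei2016, §1 ((1.3) and the operator Δ + (2/r)∂ᵣ of (1.5))] -/
theorem laplacian_add_drift_swirl_div_sq (hx : cylRadius x ≠ 0) (hu : ContDiff ℝ 3 u) :
    (Δ fun y => swirl u y * (cylRadius y ^ 2)⁻¹) x +
        2 / cylRadius x * fderiv ℝ (fun y => swirl u y * (cylRadius y ^ 2)⁻¹) x (eR x) =
      (cylRadius x ^ 2)⁻¹ * ((Δ (swirl u)) x - 2 / cylRadius x * fderiv ℝ (swirl u) x (eR x)) := by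
  rw [laplacian_swirl_div_sq hx hu,
    fderiv_swirl_div_sq_apply hx ((hu.differentiable (by norm_num)) x), inner_eR_self hx]
  field_simp
  ring

/-! ### The equation of `q = Γ/r²` -/

/-- The time derivative passes through the factor `r⁻²`. [folklore] -/
theorem timeDerivWithin_swirl_div_sq {S : Set ℝ} {U : ℝ → EuclideanSpace ℝ (Fin 3) → EuclideanSpace ℝ (Fin 3)}
    (hU : IsSmoothSpaceTimeOn S U) {t : ℝ} (ht : t ∈ S) (x : EuclideanSpace ℝ (Fin 3)) :
    timeDerivWithin S (fun s y => swirl (U s) y * (cylRadius y ^ 2)⁻¹) t x =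
      timeDerivWithin S (fun s => swirl (U s)) t x * (cylRadius x ^ 2)⁻¹ := by
  simp only [timeDerivWithin_apply]
  have hd : DifferentiableWithinAt ℝ (fun s => swirl (U s) x) S t := by
    have h := hU.differentiableWithinAt_time ht x
    have h0 : DifferentiableWithinAt ℝ (fun s => U s x 0) S t := (differentiableWithinAt_euclidean.1 h) 0
    have h1 : DifferentiableWithinAt ℝ (fun s => U s x 1) S t := (differentiableWithinAt_euclidean.1 h) 1
    simp only [swirl]
    exact (h1.const_mul _).sub (h0.const_mul _)
  exact derivWithin_mul_const hd _

/-- **Wei 2016: the equation of `q = u_θ/r = Γ/r²` off the axis.** For a classical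
Navier–Stokes solution `(u, p)` on `ℝ³ × S` (viscosity `ν`, force `f`, `S` of unique
differentiability) with axisymmetric velocity and force at all times of `S`, at every `t ∈ S`
and every `x` off the axis,
`∂ₜq + Dq[u] + 2 (u_r/r) q = ν (Δq + (2/r) Dq[e_r]) + (x₀f₁ − x₁f₀)/r²`,
`q = Γ/r²` — the swirl equation (1.3) `∂ₜΓ + u·∇Γ = ν(ΔΓ − (2/r)∂ᵣΓ) + swirl f`
(`swirl_transport_holds`, with the pressure axisymmetric by `isAxisymmetricScalar_pressure`)
divided by `r²` (`convect_swirl_div_sq`, `laplacian_add_drift_swirl_div_sq`). With `ν = 1`,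
`f = 0` this is the `u_θ`-equation of (1.1) written for `u_θ/r`, the starting point of the
`J`-equation of (1.5). [cite: Wei2016, §1 ((1.1), (1.3))] -/
theorem swirlQuot_transport {S : Set ℝ} {ν : ℝ} {f U : ℝ → EuclideanSpace ℝ (Fin 3) → EuclideanSpace ℝ (Fin 3)}
    {P : ℝ → EuclideanSpace ℝ (Fin 3) → ℝ} (h : IsClassicalNSSolutionOn S ν f U P)
    (hS : UniqueDiffOn ℝ S) (hU : ∀ t ∈ S, IsAxisymmetric (U t)) (hf : ∀ t ∈ S, IsAxisymmetric (f t))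
    {t : ℝ} (ht : t ∈ S) {x : EuclideanSpace ℝ (Fin 3)} (hx : cylRadius x ≠ 0) :
    timeDerivWithin S (fun s y => swirl (U s) y * (cylRadius y ^ 2)⁻¹) t x +
        convect (U t) (fun y => swirl (U t) y * (cylRadius y ^ 2)⁻¹) x +
        2 * (radialVelocity (U t) x / cylRadius x) * (swirl (U t) x * (cylRadius x ^ 2)⁻¹) =
      ν * ((Δ fun y => swirl (U t) y * (cylRadius y ^ 2)⁻¹) x +
          2 / cylRadius x * fderiv ℝ (fun y => swirl (U t) y * (cylRadius y ^ 2)⁻¹) x (eR x)) +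
        swirl (f t) x * (cylRadius x ^ 2)⁻¹ := by
  have hP : ∀ s ∈ S, IsAxisymmetricScalar (P s) := fun s hs =>
    h.isAxisymmetricScalar_pressure hS hU hf hs
  have hΓ := swirl_transport_holds h hU hP ht hx
  have hu3 : ContDiff ℝ 3 (U t) := (h.contDiff_velocity ht).of_le (by norm_cast)
  have hd : DifferentiableAt ℝ (U t) x := (hu3.differentiable (by norm_num)) x
  rw [timeDerivWithin_swirl_div_sq h.smooth_velocity ht x, convect_swirl_div_sq hx hd,
    laplacian_add_drift_swirl_div_sq hx hu3]
  simp only [partialDeriv] at hΓ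
  have e : timeDerivWithin S (fun s => swirl (U s)) t x =
      ν * ((Δ (swirl (U t))) x - 2 / cylRadius x * fderiv ℝ (swirl (U t)) x (eR x)) +
        swirl (f t) x - convect (U t) (swirl (U t)) x := by
    linarith
  rw [e]
  ring

end Wei2016

end Literature.Analysis.FluidPDE

end
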